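import Summits.Parity.GeneralizedHardyLittlewood.Theorems.PrimeLevelFamEdgeMomentsBeyondDiagonalDiagDecorShiftedBlockDecorSel
import HarnessLib

/-!
# Route `PrimeLevelFamEdge`, crux K_A `MomentsBeyondDiagonal` (stmt-Parity-20007), line «petersson_layers» v4, stub `stub_diag`:
# **the TWO-SIDED decorated harmonic block: both shifted coordinates decorated (`D₁` on `k₁`, `D₂` on `k₂`), and the
# instance `D₁ = D₂ = P₂` needed at order `(2,2)`**

Census R3(ii), ANALYTIC HALF; continuation of `…DiagDecorShiftedBlockDecor` (ONE decorated coordinate, p825085) for the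
generic orders. By the generic weight algebra (`…DiagDecorWeightGeneric`, `…DiagDecorOrderHecke`) the Hecke-summed weight of
EVERY order is a combination of separable monomials `M_t(k₁)·M_{t′}(k₂)·L^m·c_{ab}`; at order `(2,2)`
(`…DiagDecorOrderRungTwoHecke.heckeSum_orderTwoTwo_eq`) the top weight contains `3S₂² − 2S₄ = m₄(k₁) + m₄(k₂) + 6P₂(k₁)P₂(k₂)`,
i.e. the genuinely TWO-SIDED decoration `τP₂(k₁)·τP₂(k₂)`. In the `β + ℓ⁺` scheme (`L = 2B + ℓ⁺(k₁) + ℓ⁺(k₂)`) this needs the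
harmonic `n`-sum with BOTH shifted coordinates decorated. With abstract decorations `D₁, D₂ : ℕ → ℝ` whose shifted coordinates
`T_i^{[r]}(M,n) = Σ_c P_c(Σ_k W[(k,n)=1]τ(k)D_i(k)log^{c+r}((M/n)/k))/logᶜM` satisfy the two-scale master format with families
`(R^{(i)}_r, s_i)`:

* `abs_harmonicShiftedDecorTwo_sub_le` — **`Σ_n φW²(λlog M − log(M/n))^p T₁^{[r₁]} T₂^{[r₂]} =
  (π²/6)²(∫₀¹(λ−u)^p R^{(1)}_{r₁}(u) R^{(2)}_{r₂}(u) du)·log^{p+r₁+r₂}M·log M/log^{s₁+s₂}M + O(log^{p+r₁+r₂}M/log^{s₁+s₂}M)`**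
  (`…DiagDecorBilinearTwoScale.abs_bilinearHarmonic_two_scale_sub_le` with both inputs decorated; the one-sided lemma is the
  case `D₂ = 1`, `R^{(2)}_r = (X^rP)″`, `s₂ = 2`);
* `abs_harmonicShiftedPrimeSqTwo_sub_le` — the instance `D₁ = D₂ = P₂` (`R_r = −2X^rP`, `s = 0` on both sides, from
  `abs_shiftedCoordPrimeSq_sub_le`): main term `(π²/6)²(∫₀¹(λ−u)^p(−2u^{r₁}P(u))(−2u^{r₂}P(u))du)·log^{p+r₁+r₂}M·log M`.

The `(log g)^t` pieces and the Selberg-level block follow as in `…DiagDecorShiftedBlockDecorSel` (`selbergBlockDecor_expand`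
pattern) and are left to that pipeline. Def-free; theorems only. Helper `--supports stmt-Parity-20007`; closes nothing; K_A,
K_B and the Parity summit are NOT proved; nothing about Landau–Siegel zeros.

## References
* E. Kowalski, P. Michel, J. VanderKam, J. reine angew. Math. 526 (2000), (23)–(28) pp. 13–15 and Prop. 5.1 p. 18.
  [cite: KowalskiMichelVanderKam2000, (23)–(28) — derivation (diagonal main term in real Selberg coordinates)]
-/

noncomputable section

open scoped Real ArithmeticFunction.Moebius
open Finset ArithmeticFunction Polynomial MeasureTheory intervalIntegral

namespace Summit.Parity.GeneralizedHardyLittlewood.Theorems.MomentsBeyondDiagonal.DiagKernel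

open Literature.NumberTheory.LFunctions Literature.NumberTheory.LFunctions.KMV2000
open MollifierMainTerm (W)
open SelbergCoord (kappa)
open Literature.NumberTheory.Sieve (one_le_log_of_three_le)
open Summit.Parity.GeneralizedHardyLittlewood.Theorems.BeyondDiagonalBeatsQuarter.KernelFormXSq
  (mainConst divWeight divWeight_nonneg mainConst_nonneg)

/-! ### The harmonic main term with BOTH coordinates decorated -/

/-- **Bilinear main term, both shifted coordinates decorated** (see the module docstring; `0 ≤ λ ≤ 1`).
[cite: KowalskiMichelVanderKam2000, (23)–(28) and Prop. 5.1 — derivation] -/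
theorem abs_harmonicShiftedDecorTwo_sub_le (P : ℝ[X]) (D₁ D₂ : ℕ → ℝ) (R₁ R₂ : ℕ → ℝ[X]) (s₁ s₂ : ℕ)
    (p r₁ r₂ : ℕ) {lam : ℝ} (hlam0 : 0 ≤ lam) (hlam1 : lam ≤ 1) {C₁ C₂ : ℝ} (hC₁ : 0 ≤ C₁) (hC₂ : 0 ≤ C₂)
    (hT₁ : ∀ M : ℝ, 3 ≤ M → ∀ n : ℕ, n ≠ 0 → (n : ℝ) ≤ M →
      |(∑ c ∈ Finset.range (P.natDegree + 1), P.coeff c *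
          ((∑ k ∈ Icc 1 ⌊M / n⌋₊, (if k.Coprime n then W k else 0) * ((k.divisors.card : ℝ) * D₁ k) *
            Real.log (M / n / k) ^ (c + r₁)) / Real.log M ^ c)) / Real.log M ^ r₁ -
        mainConst n * (R₁ r₁).eval (Real.log (M / n) / Real.log M) / Real.log M ^ s₁| ≤
        C₁ * divWeight n * ((1 + kappa n) / Real.log M ^ (s₁ + 1) + 1 / ((1 + Real.log (M / n)) ^ 2 * Real.log M ^ s₁)))
    (hT₂ : ∀ M : ℝ, 3 ≤ M → ∀ n : ℕ, n ≠ 0 → (n : ℝ) ≤ M →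
      |(∑ c ∈ Finset.range (P.natDegree + 1), P.coeff c *
          ((∑ k ∈ Icc 1 ⌊M / n⌋₊, (if k.Coprime n then W k else 0) * ((k.divisors.card : ℝ) * D₂ k) *
            Real.log (M / n / k) ^ (c + r₂)) / Real.log M ^ c)) / Real.log M ^ r₂ -
        mainConst n * (R₂ r₂).eval (Real.log (M / n) / Real.log M) / Real.log M ^ s₂| ≤
        C₂ * divWeight n * ((1 + kappa n) / Real.log M ^ (s₂ + 1) + 1 / ((1 + Real.log (M / n)) ^ 2 * Real.log M ^ s₂))) :
    ∃ C : ℝ, 0 < C ∧ ∀ M : ℝ, 3 ≤ M →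
      |∑ n ∈ Icc 1 ⌊M⌋₊, (Nat.totient n : ℝ) * W n ^ 2 *
          ((lam * Real.log M - Real.log (M / n)) ^ p *
            (∑ c ∈ Finset.range (P.natDegree + 1), P.coeff c *
              ((∑ k ∈ Icc 1 ⌊M / n⌋₊, (if k.Coprime n then W k else 0) * ((k.divisors.card : ℝ) * D₁ k) *
                Real.log (M / n / k) ^ (c + r₁)) / Real.log M ^ c)) *
            (∑ c ∈ Finset.range (P.natDegree + 1), P.coeff c *
              ((∑ k ∈ Icc 1 ⌊M / n⌋₊, (if k.Coprime n then W k else 0) * ((k.divisors.card : ℝ) * D₂ k) *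
                Real.log (M / n / k) ^ (c + r₂)) / Real.log M ^ c))) -
        (π ^ 2 / 6) ^ 2 * (∫ u in (0 : ℝ)..1,
            (((Polynomial.C lam - X) ^ p * R₁ r₁) * R₂ r₂).eval u) *
          Real.log M ^ (p + r₁ + r₂) * Real.log M / Real.log M ^ (s₁ + s₂)| ≤
        C * Real.log M ^ (p + r₁ + r₂) / Real.log M ^ (s₁ + s₂) := by
  set T₁ : ℝ → ℕ → ℝ := fun M n ↦ (lam - Real.log (M / n) / Real.log M) ^ p *
    ((∑ c ∈ Finset.range (P.natDegree + 1), P.coeff c *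
      ((∑ k ∈ Icc 1 ⌊M / n⌋₊, (if k.Coprime n then W k else 0) * ((k.divisors.card : ℝ) * D₁ k) *
        Real.log (M / n / k) ^ (c + r₁)) / Real.log M ^ c)) / Real.log M ^ r₁) with hT₁def
  set T₂ : ℝ → ℕ → ℝ := fun M n ↦
    (∑ c ∈ Finset.range (P.natDegree + 1), P.coeff c *
      ((∑ k ∈ Icc 1 ⌊M / n⌋₊, (if k.Coprime n then W k else 0) * ((k.divisors.card : ℝ) * D₂ k) *
        Real.log (M / n / k) ^ (c + r₂)) / Real.log M ^ c)) / Real.log M ^ r₂ with hT₂def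
  set Q₁ : ℝ[X] := (Polynomial.C lam - X) ^ p * R₁ r₁ with hQ₁
  set Q₂ : ℝ[X] := R₂ r₂ with hQ₂
  have hT₁' : ∀ M : ℝ, 3 ≤ M → ∀ n : ℕ, n ≠ 0 → (n : ℝ) ≤ M →
      |T₁ M n - mainConst n * Q₁.eval (Real.log (M / n) / Real.log M) / Real.log M ^ s₁| ≤
        C₁ * divWeight n * ((1 + kappa n) / Real.log M ^ (s₁ + 1) +
          1 / ((1 + Real.log (M / n)) ^ 2 * Real.log M ^ s₁)) := by
    intro M hM n hn hnM
    have hℓ1 : 1 ≤ Real.log M := one_le_log_of_three_le hM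
    have hℓpos : 0 < Real.log M := by linarith
    obtain ⟨hY0, hYℓ⟩ := log_div_nonneg_and_le hM hn hnM
    set u := Real.log (M / n) / Real.log M with hu
    have hu0 : 0 ≤ u := div_nonneg hY0 hℓpos.le
    have hu1 : u ≤ 1 := (div_le_one hℓpos).2 hYℓ
    have hfac : |(lam - u) ^ p| ≤ 1 := by
      rw [abs_pow]
      exact pow_le_one₀ (abs_nonneg _) (abs_le.2 ⟨by linarith, by linarith⟩)
    have hQ₁eval : Q₁.eval u = (lam - u) ^ p * (R₁ r₁).eval u := by
      simp only [hQ₁, Polynomial.eval_mul, Polynomial.eval_pow, Polynomial.eval_sub, Polynomial.eval_C,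
        Polynomial.eval_X]
    have hdiff : T₁ M n - mainConst n * Q₁.eval u / Real.log M ^ s₁ =
        (lam - u) ^ p * ((∑ c ∈ Finset.range (P.natDegree + 1), P.coeff c *
          ((∑ k ∈ Icc 1 ⌊M / n⌋₊, (if k.Coprime n then W k else 0) * ((k.divisors.card : ℝ) * D₁ k) *
            Real.log (M / n / k) ^ (c + r₁)) / Real.log M ^ c)) / Real.log M ^ r₁ -
          mainConst n * (R₁ r₁).eval u / Real.log M ^ s₁) := by
      rw [hT₁def, hQ₁eval]; ring
    rw [hdiff, abs_mul]
    have h := hT₁ M hM n hn hnM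
    calc |(lam - u) ^ p| * _ ≤ 1 * (C₁ * divWeight n * ((1 + kappa n) / Real.log M ^ (s₁ + 1) +
          1 / ((1 + Real.log (M / n)) ^ 2 * Real.log M ^ s₁))) :=
          mul_le_mul hfac h (abs_nonneg _) zero_le_one
      _ = _ := one_mul _
  have hT₂' : ∀ M : ℝ, 3 ≤ M → ∀ n : ℕ, n ≠ 0 → (n : ℝ) ≤ M →
      |T₂ M n - mainConst n * Q₂.eval (Real.log (M / n) / Real.log M) / Real.log M ^ s₂| ≤
        C₂ * divWeight n * ((1 + kappa n) / Real.log M ^ (s₂ + 1) +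
          1 / ((1 + Real.log (M / n)) ^ 2 * Real.log M ^ s₂)) := by
    intro M hM n hn hnM
    simpa only [hT₂def, hQ₂] using hT₂ M hM n hn hnM
  obtain ⟨C, hC, h⟩ := abs_bilinearHarmonic_two_scale_sub_le Q₁ Q₂ s₁ s₂ T₁ T₂ hC₁ hC₂ hT₁' hT₂'
  refine ⟨C, hC, fun M hM ↦ ?_⟩
  have hℓ1 : 1 ≤ Real.log M := one_le_log_of_three_le hM
  have hℓpos : 0 < Real.log M := by linarith
  have hℓ0 : Real.log M ≠ 0 := hℓpos.ne'
  have h' := h M hM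
  have hresc : ∑ n ∈ Icc 1 ⌊M⌋₊, (Nat.totient n : ℝ) * W n ^ 2 *
      ((lam * Real.log M - Real.log (M / n)) ^ p *
        (∑ c ∈ Finset.range (P.natDegree + 1), P.coeff c *
          ((∑ k ∈ Icc 1 ⌊M / n⌋₊, (if k.Coprime n then W k else 0) * ((k.divisors.card : ℝ) * D₁ k) *
            Real.log (M / n / k) ^ (c + r₁)) / Real.log M ^ c)) *
        (∑ c ∈ Finset.range (P.natDegree + 1), P.coeff c *
          ((∑ k ∈ Icc 1 ⌊M / n⌋₊, (if k.Coprime n then W k else 0) * ((k.divisors.card : ℝ) * D₂ k) *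
            Real.log (M / n / k) ^ (c + r₂)) / Real.log M ^ c))) =
      Real.log M ^ (p + r₁ + r₂) * ∑ n ∈ Icc 1 ⌊M⌋₊, (Nat.totient n : ℝ) * W n ^ 2 * (T₁ M n * T₂ M n) := by
    rw [Finset.mul_sum]
    refine Finset.sum_congr rfl fun n _ ↦ ?_
    have hfac : (lam * Real.log M - Real.log (M / n)) ^ p =
        Real.log M ^ p * (lam - Real.log (M / n) / Real.log M) ^ p := by
      rw [← mul_pow]; congr 1; field_simp
    simp only [hT₁def, hT₂def]
    rw [hfac, pow_add, pow_add]
    field_simp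
  rw [hresc]
  have e : Real.log M ^ (p + r₁ + r₂) * ∑ n ∈ Icc 1 ⌊M⌋₊, (Nat.totient n : ℝ) * W n ^ 2 * (T₁ M n * T₂ M n) -
      (π ^ 2 / 6) ^ 2 * (∫ u in (0 : ℝ)..1, (Q₁ * Q₂).eval u) * Real.log M ^ (p + r₁ + r₂) * Real.log M /
        Real.log M ^ (s₁ + s₂) =
      Real.log M ^ (p + r₁ + r₂) * (∑ n ∈ Icc 1 ⌊M⌋₊, (Nat.totient n : ℝ) * W n ^ 2 * (T₁ M n * T₂ M n) -
        (π ^ 2 / 6) ^ 2 * (∫ u in (0 : ℝ)..1, (Q₁ * Q₂).eval u) * Real.log M / Real.log M ^ (s₁ + s₂)) := by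
    ring
  rw [e, abs_mul, abs_of_pos (pow_pos hℓpos _)]
  calc Real.log M ^ (p + r₁ + r₂) * _ ≤ Real.log M ^ (p + r₁ + r₂) * (C / Real.log M ^ (s₁ + s₂)) :=
        mul_le_mul_of_nonneg_left h' (pow_nonneg hℓpos.le _)
    _ = C * Real.log M ^ (p + r₁ + r₂) / Real.log M ^ (s₁ + s₂) := by ring

/-! ### The instance `D₁ = D₂ = P₂` (order `(2,2)`) -/

/-- **Both coordinates decorated with `P₂(k) = Σ_{p∣k}log²p`** (`R_r = −2X^rP`, `s = 0` on each side; `0 ≤ λ ≤ 1`,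
`P₀ = P₁ = 0`): `Σ_n φW²(λlog M − log(M/n))^p T_{P₂}^{[r₁]} T_{P₂}^{[r₂]} =
(π²/6)²(∫₀¹(λ−u)^p(−2u^{r₁}P)(−2u^{r₂}P))·log^{p+r₁+r₂}M·log M + O(log^{p+r₁+r₂}M)` — the two-sided `τP₂·τP₂` input of
order `(2,2)`. [cite: KowalskiMichelVanderKam2000, (23)–(28) and Prop. 5.1 — derivation] -/
theorem abs_harmonicShiftedPrimeSqTwo_sub_le (P : ℝ[X]) (hP0 : P.coeff 0 = 0) (hP1 : P.coeff 1 = 0) (p r₁ r₂ : ℕ)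
    {lam : ℝ} (hlam0 : 0 ≤ lam) (hlam1 : lam ≤ 1) :
    ∃ C : ℝ, 0 < C ∧ ∀ M : ℝ, 3 ≤ M →
      |∑ n ∈ Icc 1 ⌊M⌋₊, (Nat.totient n : ℝ) * W n ^ 2 *
          ((lam * Real.log M - Real.log (M / n)) ^ p *
            (∑ c ∈ Finset.range (P.natDegree + 1), P.coeff c *
              ((∑ k ∈ Icc 1 ⌊M / n⌋₊, (if k.Coprime n then W k else 0) *
                  ((k.divisors.card : ℝ) * ∑ p ∈ k.primeFactors, Real.log p ^ 2) *
                Real.log (M / n / k) ^ (c + r₁)) / Real.log M ^ c)) *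
            (∑ c ∈ Finset.range (P.natDegree + 1), P.coeff c *
              ((∑ k ∈ Icc 1 ⌊M / n⌋₊, (if k.Coprime n then W k else 0) *
                  ((k.divisors.card : ℝ) * ∑ p ∈ k.primeFactors, Real.log p ^ 2) *
                Real.log (M / n / k) ^ (c + r₂)) / Real.log M ^ c))) -
        (π ^ 2 / 6) ^ 2 * (∫ u in (0 : ℝ)..1,
            (((Polynomial.C lam - X) ^ p * (-(2 : ℝ) • (X ^ r₁ * P))) * (-(2 : ℝ) • (X ^ r₂ * P))).eval u) *
          Real.log M ^ (p + r₁ + r₂) * Real.log M / Real.log M ^ (0 + 0)| ≤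
        C * Real.log M ^ (p + r₁ + r₂) / Real.log M ^ (0 + 0) := by
  obtain ⟨C₁, hC₁, h₁⟩ := abs_shiftedCoordPrimeSq_sub_le P hP0 hP1 r₁
  obtain ⟨C₂, hC₂, h₂⟩ := abs_shiftedCoordPrimeSq_sub_le P hP0 hP1 r₂
  exact abs_harmonicShiftedDecorTwo_sub_le P (fun k ↦ ∑ p ∈ k.primeFactors, Real.log p ^ 2)
    (fun k ↦ ∑ p ∈ k.primeFactors, Real.log p ^ 2) (fun r' : ℕ ↦ -(2 : ℝ) • (X ^ r' * P))
    (fun r' : ℕ ↦ -(2 : ℝ) • (X ^ r' * P)) 0 0 p r₁ r₂ hlam0 hlam1 hC₁ hC₂ h₁ h₂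

end Summit.Parity.GeneralizedHardyLittlewood.Theorems.MomentsBeyondDiagonal.DiagKernel

end
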